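import Summits.BirchSwinnertonDyer.BirchSwinnertonDyer.Theorems.ByReductionTypeAtTwoOrdKatoHalfAtTwoIsoResidueConj
import HarnessLib

/-!
# Route ByReductionTypeAtTwo, crux `OrdKatoHalfAtTwoIso` (stmt-BirchSwinnertonDyer-19573), line `steinberg-fibre-at-two`
# (skeleton v11), stub `stub_coreA_posDisc : CoreTheoremAPosDiscTwo` (the core Theorem A at `2` on `0 < Δ`): helper W-Δ⁺ —
# when `0 < Δ`, complex conjugation acts TRIVIALLY on `E[2]`

Seat `cruxlead-stmt-BirchSwinnertonDyer-19573-g5` (LEAD PROVER, MODE LINE; HOME `run/shared/lean/pub/bsd-2adic/`; `--supports`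
stmt-BirchSwinnertonDyer-19573 as helper). THEOREMS ONLY. HONEST FRAMING (cell bsd-2adic): BSD is not proved by any of this;
the crux is not proved; the stub `CoreTheoremAPosDiscTwo` (p684479) is NOT proved here. This is the `0 < Δ` companion of
the line's helper W-Δ (`…ResidueConj.lean`, v4: at `Δ < 0` complex conjugation is a TRANSPOSITION on `E[2]`), i.e. the first
line of the real-place analysis in the lead's `STUB-BRIEF-stub_coreA_posDisc.md` (brief (P2)): on the stub's habitat every
complex conjugation `c` fixes `E[2]` pointwise, so `H¹(ℚ_w, 𝒯_J(E)) = Hom(Gal(ℂ/ℝ), 𝒯_J(E)) = 𝒯_J(E) ≠ 0` — the line's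
Step-4 hypothesis `hinf` (H14) is unavailable there, and the archimedean term of Poitou–Tate has to be killed on the paired
classes themselves (`…StepFourOfXInf.lean`, p685843).

Contents (sorry-free, no named fact, no instance):
* `smul_delta_eq_self_of_isComplexConjugation_of_Δ_pos` — if `0 < Δ` then `c • δ = δ` (`(ι δ)² = Δ/16 > 0` is a positive real,
  so `ι δ ∈ ℝ`, `conj (ι δ) = ι δ`, and `ι` is injective).
* `sign_permGal_eq_one_of_isComplexConjugation_of_Δ_pos` — hence `c` is EVEN on `{T₀, T₁, T₂}` (`c • δ = sign · δ`, `δ ≠ 0`).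
* `permGal_eq_one_of_isComplexConjugation_of_Δ_pos` — an even permutation of three letters whose square is `1` (`c² = 1`) is
  the identity: `c` FIXES the three letters.
* `smul_eq_self_of_isComplexConjugation_of_Δ_pos` — so `c • P = P` for every `P ∈ E[2]` (`E[2] = {O, T₀, T₁, T₂}`): on `0 < Δ`
  the three nonzero `2`-torsion points are real.

References: J. H. Silverman, *The Arithmetic of Elliptic Curves*, 2nd ed., GTM 106 (2009), III.§1, III.§7 [SilvermanAEC2009];
T. Dokchitser, V. Dokchitser, Math. Z. 272 (2012) 961–964, proof of Theorem (1) ("`ℚ(E[2]) ⊃ ℚ(√Δ)`")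
[DokchitserDokchitserMathZ2012]; tree `…ResidueConj.lean` (the `Δ < 0` twin), `TwoTorsionGaloisActionProofs.lean` (`permGal`).
-/

set_option autoImplicit false
set_option linter.dupNamespace false

noncomputable section

open WeierstrassCurve
open Literature.NumberTheory.EllipticCurves.DokchitserDokchitser2012 Literature.NumberTheory.GaloisRepresentations

-- D-0017: single-problem summit, so `Summit.BirchSwinnertonDyer.BirchSwinnertonDyer.…` repeats a namespace BY DESIGN.
namespace Summit.BirchSwinnertonDyer.BirchSwinnertonDyer.Theorems.SteinbergFibreAtTwo

/-- A complex number whose square is a positive rational is real: `conj z = z`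
(`z = a + bi`, `z² = a² - b² + 2ab·i`; `2ab = 0` and `a² - b² > 0` force `b = 0`). [folklore] -/
private theorem conj_eq_self_of_sq_eq_ratCast_of_pos {z : ℂ} {q : ℚ} (hz : z ^ 2 = (q : ℂ))
    (hq : 0 < q) : starRingEnd ℂ z = z := by
  have hre : z.re * z.re - z.im * z.im = q := by
    have h := congrArg Complex.re hz
    rwa [pow_two, Complex.mul_re, Complex.ratCast_re] at h
  have him : z.re * z.im + z.im * z.re = 0 := by
    have h := congrArg Complex.im hz
    rwa [pow_two, Complex.mul_im, Complex.ratCast_im] at h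
  have hri : z.re * z.im = 0 := by linear_combination him / 2
  have hq' : (0 : ℝ) < (q : ℝ) := by exact_mod_cast hq
  rcases mul_eq_zero.mp hri with h0 | h0
  · exfalso
    rw [h0, zero_mul, zero_sub] at hre
    nlinarith [mul_self_nonneg z.im]
  · exact Complex.ext (by simp) (by simp [h0])

/-- **Helper W-Δ⁺, first form: complex conjugation fixes `δ = √(Δ/16)` when `0 < Δ`.** For an elliptic `W/ℚ` with `0 < Δ`
and a complex conjugation `c ∈ Γ_ℚ` (`ι (c • x) = conj (ι x)` for some `ι : ℚ̄ →+* ℂ`): `c • δ = δ`, because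
`(ι δ)² = Δ/16 > 0` makes `ι δ` real and `ι` is injective. [cite: SilvermanAEC2009, III.§1] -/
theorem smul_delta_eq_self_of_isComplexConjugation_of_Δ_pos (W : WeierstrassCurve ℚ) [W.IsElliptic]
    {φ : ℚ →+* ℝ} {c : Field.absoluteGaloisGroup ℚ} (hc : IsComplexConjugation φ c) (hΔ : 0 < W.Δ) :
    c • delta W two_ne_zero = delta W two_ne_zero := by
  obtain ⟨ι, -, hι⟩ := isComplexConjugation_iff.mp hc
  have h16 : (16 : ℂ) * ι (delta W two_ne_zero) ^ 2 = (W.Δ : ℂ) := by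
    have h := congrArg ι (algebraMap_Δ W two_ne_zero)
    simp only [map_mul, map_pow, map_ofNat] at h
    rw [eq_ratCast, map_ratCast] at h
    exact h.symm
  have hsq : ι (delta W two_ne_zero) ^ 2 = ((W.Δ / 16 : ℚ) : ℂ) := by
    have h16' : (16 : ℂ) ≠ 0 := by norm_num
    push_cast
    rw [eq_div_iff h16', ← h16, mul_comm]
  have hq : 0 < W.Δ / 16 := div_pos hΔ (by norm_num)
  apply ι.injective
  rw [hι, conj_eq_self_of_sq_eq_ratCast_of_pos hsq hq]

/-- **Helper W-Δ⁺: complex conjugation is EVEN on `E[2]` when `0 < Δ`** (`sign (permGal c) = 1`): `c • δ = sign(permGal c) · δ`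
(`smul_delta`, "`ℚ(E[2]) ⊃ ℚ(√Δ)`") and `c • δ = δ`, with `δ ≠ 0` in characteristic `0`.
[cite: DokchitserDokchitserMathZ2012, Theorem (1) (proof)] -/
theorem sign_permGal_eq_one_of_isComplexConjugation_of_Δ_pos (W : WeierstrassCurve ℚ) [W.IsElliptic]
    {φ : ℚ →+* ℝ} {c : Field.absoluteGaloisGroup ℚ} (hc : IsComplexConjugation φ c) (hΔ : 0 < W.Δ) :
    Equiv.Perm.sign (permGal W two_ne_zero c) = 1 := by
  rcases Int.units_eq_one_or (Equiv.Perm.sign (permGal W two_ne_zero c)) with h | h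
  · exact h
  · exfalso
    have h1 := smul_delta W two_ne_zero c
    rw [smul_delta_eq_self_of_isComplexConjugation_of_Δ_pos W hc hΔ, h, Units.val_neg, Units.val_one,
      Int.cast_neg, Int.cast_one, neg_mul, one_mul, eq_comm, CharZero.neg_eq_self_iff] at h1
    exact delta_ne_zero W two_ne_zero h1

/-- An even permutation of three letters whose square is the identity is the identity (`A₃ = {1, (012), (021)}` has no
involution). [folklore] -/
private theorem perm_fin_three_eq_one_of_sign_eq_one_of_mul_self {p : Equiv.Perm (Fin 3)}
    (hsign : Equiv.Perm.sign p = 1) (hsq : p * p = 1) : p = 1 := by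
  revert p
  decide

/-- **Helper W-Δ⁺: complex conjugation FIXES the three nonzero `2`-torsion points when `0 < Δ`** (`permGal c = 1`): it is even
(`sign_permGal_eq_one_of_isComplexConjugation_of_Δ_pos`) and an involution (`c² = 1`, `IsComplexConjugation.sq_eq_one`,
`permGal` multiplicative), and `A₃` has no element of order `2`. [cite: SilvermanAEC2009, III.§7 (the representation G_{K̄/K} → Aut(E[m]))] -/
theorem permGal_eq_one_of_isComplexConjugation_of_Δ_pos (W : WeierstrassCurve ℚ) [W.IsElliptic]
    {φ : ℚ →+* ℝ} {c : Field.absoluteGaloisGroup ℚ} (hc : IsComplexConjugation φ c) (hΔ : 0 < W.Δ) :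
    permGal W two_ne_zero c = 1 := by
  refine perm_fin_three_eq_one_of_sign_eq_one_of_mul_self
    (sign_permGal_eq_one_of_isComplexConjugation_of_Δ_pos W hc hΔ) ?_
  rw [← permGal_mul, ← pow_two, hc.sq_eq_one, permGal_one]

/-- **Helper W-Δ⁺, consumer shape: on `0 < Δ` every complex conjugation acts TRIVIALLY on `E[2]`** — `c • P = P` for every
`2`-torsion point `P` (`E[2] = {O, T₀, T₁, T₂}` and `c • T_i = T_{permGal c i} = T_i`). Hence `H¹(ℝ, E[2]) = E[2] ≠ 0`: the
line's Step-4 hypothesis `H¹(ℚ_w, 𝒯_J(E)) = 0` (H14) fails at `0 < Δ`.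
[cite: SilvermanAEC2009, Cor. III.6.4(b) and III.§7] -/
theorem smul_eq_self_of_isComplexConjugation_of_Δ_pos (W : WeierstrassCurve ℚ) [W.IsElliptic]
    {φ : ℚ →+* ℝ} {c : Field.absoluteGaloisGroup ℚ} (hc : IsComplexConjugation φ c) (hΔ : 0 < W.Δ)
    (P : WeierstrassCurve.geomTorsion W 2) : c • P = P := by
  rcases eq_zero_or_eq_T W two_ne_zero P with rfl | ⟨i, rfl⟩
  · exact smul_zero c
  · rw [← T_permGal, permGal_eq_one_of_isComplexConjugation_of_Δ_pos W hc hΔ, Equiv.Perm.one_apply]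

end Summit.BirchSwinnertonDyer.BirchSwinnertonDyer.Theorems.SteinbergFibreAtTwo

end
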